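import Literature.AlgebraicGeometry.RealAlgebraic.ComplexOrientationFormulaSheets
import Literature.AlgebraicGeometry.RealAlgebraic.ComplexOrientationFormulaGroundwork
import HarnessLib

/-!
# The signed fibre sum of a dividing curve over the upper half `ξ`-plane (Rokhlin, layer 5)

Sibling proof file of `ComplexOrientationFormula.lean` (topic
`Literature/AlgebraicGeometry/RealAlgebraic`), sequel to `ComplexOrientationFormulaSheets.lean`.
Everything here is PROVED; no definition and no named fact is introduced.

Setting (the hypotheses are carried explicitly by each statement): `p ∈ ℚ[x, y]`; a rational
direction `c`; a monic `Q ∈ ℚ[ξ][Y]` of degree `d ≥ 1`, irreducible over `ℂ`, whose fibre roots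
over `ξ` are exactly the `y` with `p(ξ + c y, y) = 0` (the normalised sheared polynomial); a set
`H ⊆ ℂ²` which is a *half* of `p` such that the non-real locus is `H ⊔ conj H` (Rokhlin's two
halves); and the **signed fibre sum**

  `F(ξ) = Σ_{Q(ξ, y) = 0} η(ξ, y) · y`,  `η(ξ, y) = +1` if `(ξ + cy, y) ∈ H`, `-1` otherwise,

(roots with multiplicity), given as a function `F` together with this defining formula. Over
`Im ξ > 0` every point `(ξ + cy, y)` of the curve is non-real, so `η` records the half it lies in.
Results:

* `mem_nonRealLocus_of_im_pos` — fibre points over the upper half-plane are non-real points of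
  the curve; `mem_half_iff_of_isPreconnected` — along a connected family of non-real curve points
  the half does not change;
* `differentiableOn_fibreSum` — `F` is holomorphic on the upper half-plane off the finite set of
  `ξ` over which the fibre has a multiple root (local holomorphic sheets with locally constant
  signs);
* `norm_fibreSum_le` — `|F(ξ)| ≤ d · (root bound)`, locally bounded;
* `exists_holomorphic_fibreSum` — hence (Riemann) a function `F'` holomorphic on the whole upper
  half-plane agreeing with `F` off that finite set.

[folklore] (Rokhlin 1974 reads the complex orientation formula off `∂H̄ = ℝA`; the fibre sum over a
half is the device replacing integration over the bordered surface `H̄` in this tree.)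

## References

* V. A. Rokhlin, Complex orientations of real algebraic curves, Funct. Anal. Appl. 8 (1974)
  331–334, §§2–3. [Rokhlin1974]
* L. V. Ahlfors, *Complex Analysis*, 3rd ed. (1979), Ch. 8 §2 (algebraic functions). [folklore]
-/

noncomputable section

open Polynomial Set Filter Metric MvPolynomial
open scoped _root_.Topology _root_.ComplexConjugate Classical

namespace Literature.AlgebraicGeometry.RealAlgebraic

namespace Sheets

variable {p : MvPolynomial (Fin 2) ℚ} {c : ℚ} {Q : ℚ[X][X]} {H : Set (Fin 2 → ℂ)} {F : ℂ → ℂ}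

/-! ### Fibre points over the upper half-plane are non-real -/

/-- Over `Im ξ > 0` every point `(ξ + cy, y)` is non-real: if `y` is real, the first coordinate
has imaginary part `Im ξ > 0`. [folklore] -/
theorem exists_im_ne_zero_of_im_pos (c : ℚ) {ξ : ℂ} (hξ : 0 < ξ.im) (y : ℂ) :
    ∃ i : Fin 2, ((![ξ + (c : ℂ) * y, y] : Fin 2 → ℂ) i).im ≠ 0 := by
  by_cases hy : y.im = 0
  · refine ⟨0, ?_⟩
    simp [hy, hξ.ne']
  · exact ⟨1, by simpa using hy⟩

/-- Fibre roots over the upper half-plane give points of the non-real locus. [folklore] -/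
theorem mem_nonRealLocus_of_im_pos
    (hQp : ∀ ξ y : ℂ, (Q.map (eval₂RingHom (algebraMap ℚ ℂ) ξ)).eval y = 0 ↔
      aeval (![ξ + (c : ℂ) * y, y] : Fin 2 → ℂ) p = 0)
    {ξ : ℂ} (hξ : 0 < ξ.im) {y : ℂ} (hy : (Q.map (eval₂RingHom (algebraMap ℚ ℂ) ξ)).eval y = 0) :
    (![ξ + (c : ℂ) * y, y] : Fin 2 → ℂ) ∈ nonRealLocus p :=
  ⟨(hQp ξ y).1 hy, exists_im_ne_zero_of_im_pos c hξ y⟩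

/-! ### The half does not change along connected families of non-real points -/

/-- **Two halves, locally constant membership.** If `H` is a half and the non-real locus is
`H ⊔ conj H`, then along a preconnected set of non-real curve points membership in `H` is
constant. [cite: Rokhlin1974, §2] -/
theorem mem_half_iff_of_isPreconnected (hH : IsHalf p H) (hN : nonRealLocus p = H ∪ star '' H)
    (hdisj : Disjoint H (star '' H)) {s : Set (Fin 2 → ℂ)} (hs : IsPreconnected s)
    (hsub : s ⊆ nonRealLocus p) {w₀ : Fin 2 → ℂ} (hw₀ : w₀ ∈ s) {w : Fin 2 → ℂ} (hw : w ∈ s) :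
    w ∈ H ↔ w₀ ∈ H := by
  have hhalf : s ⊆ half p w₀ := subset_half_of_isPreconnected hs hsub hw₀
  by_cases h₀ : w₀ ∈ H
  · rw [← hH.eq_half h₀] at hhalf
    exact iff_of_true (hhalf hw) h₀
  · have hw₀' : w₀ ∈ star '' H := by
      have := hsub hw₀
      rw [hN] at this
      exact this.resolve_left h₀
    rw [← hH.image_star.eq_half hw₀'] at hhalf
    exact iff_of_false (fun hwH => Set.disjoint_left.1 hdisj hwH (hhalf hw)) h₀

/-- The sign attached to a point: `+1` on `H`, `-1` off `H`; constant along preconnected sets of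
non-real points. [folklore] -/
theorem sign_eq_of_isPreconnected (hH : IsHalf p H) (hN : nonRealLocus p = H ∪ star '' H)
    (hdisj : Disjoint H (star '' H)) {s : Set (Fin 2 → ℂ)} (hs : IsPreconnected s)
    (hsub : s ⊆ nonRealLocus p) {w₀ : Fin 2 → ℂ} (hw₀ : w₀ ∈ s) {w : Fin 2 → ℂ} (hw : w ∈ s) :
    (if w ∈ H then (1 : ℂ) else -1) = (if w₀ ∈ H then (1 : ℂ) else -1) := by
  rw [mem_half_iff_of_isPreconnected hH hN hdisj hs hsub hw₀ hw]

/-! ### The fibre sum along local sheets -/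

/-- Along local sheets `y₁, …, y_d` exhausting the root multiset, the fibre sum is the finite sum
`Σⱼ η(ξ, yⱼ(ξ)) yⱼ(ξ)`. [folklore] -/
theorem fibreSum_eq_sum_sheets
    (hF : ∀ ξ : ℂ, F ξ = (((Q.map (eval₂RingHom (algebraMap ℚ ℂ) ξ)).roots.map fun y =>
      (if (![ξ + (c : ℂ) * y, y] : Fin 2 → ℂ) ∈ H then (1 : ℂ) else -1) * y)).sum)
    {ι : Type*} [Fintype ι] {y : ι → ℂ → ℂ} {ξ : ℂ}
    (hroots : (Q.map (eval₂RingHom (algebraMap ℚ ℂ) ξ)).roots = Finset.univ.val.map fun j => y j ξ) :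
    F ξ = ∑ j, (if (![ξ + (c : ℂ) * y j ξ, y j ξ] : Fin 2 → ℂ) ∈ H then (1 : ℂ) else -1) * y j ξ := by
  rw [hF, hroots, Multiset.map_map, Finset.sum_eq_multiset_sum]
  rfl

/-- **Local constancy of the signs along sheets over the upper half-plane.** On a ball inside the
upper half-plane carrying local sheets, each sign `η(ξ, yⱼ(ξ))` is constant. [folklore] -/
theorem sign_sheet_eq (hH : IsHalf p H) (hN : nonRealLocus p = H ∪ star '' H)
    (hdisj : Disjoint H (star '' H))
    (hQp : ∀ ξ y : ℂ, (Q.map (eval₂RingHom (algebraMap ℚ ℂ) ξ)).eval y = 0 ↔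
      aeval (![ξ + (c : ℂ) * y, y] : Fin 2 → ℂ) p = 0)
    {D : Set ℂ} (hD : IsPreconnected D) (hDim : ∀ ξ ∈ D, 0 < ξ.im)
    {g : ℂ → ℂ} (hg : ContinuousOn g D)
    (hroot : ∀ ξ ∈ D, (Q.map (eval₂RingHom (algebraMap ℚ ℂ) ξ)).eval (g ξ) = 0)
    {ξ₀ : ℂ} (hξ₀ : ξ₀ ∈ D) {ξ : ℂ} (hξ : ξ ∈ D) :
    (if (![ξ + (c : ℂ) * g ξ, g ξ] : Fin 2 → ℂ) ∈ H then (1 : ℂ) else -1) =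
      (if (![ξ₀ + (c : ℂ) * g ξ₀, g ξ₀] : Fin 2 → ℂ) ∈ H then (1 : ℂ) else -1) := by
  set Φ : ℂ → Fin 2 → ℂ := fun ξ => ![ξ + (c : ℂ) * g ξ, g ξ] with hΦ
  have hcont : ContinuousOn Φ D := by
    refine continuousOn_pi.2 fun i => ?_
    fin_cases i
    · exact (continuousOn_id.add (continuousOn_const.mul hg))
    · exact hg
  have hpre : IsPreconnected (Φ '' D) := hD.image Φ hcont
  have hsub : Φ '' D ⊆ nonRealLocus p := by
    rintro _ ⟨ξ, hξ, rfl⟩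
    exact mem_nonRealLocus_of_im_pos hQp (hDim ξ hξ) (hroot ξ hξ)
  exact sign_eq_of_isPreconnected hH hN hdisj hpre hsub (mem_image_of_mem Φ hξ₀)
    (mem_image_of_mem Φ hξ)

/-! ### Holomorphy off the multiple fibres -/

/-- **The fibre sum is holomorphic over the upper half-plane off the multiple fibres.** With a
Bézout identity `A Q + B ∂_Y Q = g`, `F` is complex differentiable at every `ξ₀`, `Im ξ₀ > 0`,
with `g(ξ₀) ≠ 0`. [folklore] -/
theorem differentiableAt_fibreSum (hH : IsHalf p H) (hN : nonRealLocus p = H ∪ star '' H)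
    (hdisj : Disjoint H (star '' H)) (hmonic : Q.Monic)
    (hQp : ∀ ξ y : ℂ, (Q.map (eval₂RingHom (algebraMap ℚ ℂ) ξ)).eval y = 0 ↔
      aeval (![ξ + (c : ℂ) * y, y] : Fin 2 → ℂ) p = 0)
    (hF : ∀ ξ : ℂ, F ξ = (((Q.map (eval₂RingHom (algebraMap ℚ ℂ) ξ)).roots.map fun y =>
      (if (![ξ + (c : ℂ) * y, y] : Fin 2 → ℂ) ∈ H then (1 : ℂ) else -1) * y)).sum)
    {A B : ℚ[X][X]} {g : ℚ[X]} (hbez : A * Q + B * derivative Q = Polynomial.C g)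
    {ξ₀ : ℂ} (hξ₀ : 0 < ξ₀.im) (hg : Polynomial.aeval ξ₀ g ≠ 0) :
    DifferentiableAt ℂ F ξ₀ := by
  have hsimple : ∀ y : ℂ, (Q.map (eval₂RingHom (algebraMap ℚ ℂ) ξ₀)).IsRoot y →
      ¬ (derivative (Q.map (eval₂RingHom (algebraMap ℚ ℂ) ξ₀))).IsRoot y :=
    fun y hy hy' => hg (aeval_eq_zero_of_isRoot_of_isRoot_derivative hbez hy hy')
  obtain ⟨ε, hε, y, hya, -, hroots⟩ := exists_localSheets hmonic hsimple
  -- shrink the ball into the upper half-plane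
  set δ : ℝ := min ε ξ₀.im with hδ
  have hδpos : 0 < δ := lt_min hε hξ₀
  have hball : ball ξ₀ δ ⊆ ball ξ₀ ε := ball_subset_ball (min_le_left _ _)
  have him : ∀ ξ ∈ ball ξ₀ δ, 0 < ξ.im := by
    intro ξ hξ
    have h1 : |ξ.im - ξ₀.im| < ξ₀.im := by
      have := Complex.abs_im_le_norm (ξ - ξ₀)
      rw [Complex.sub_im] at this
      exact this.trans_lt ((mem_ball_iff_norm.1 hξ).trans_le (min_le_right _ _))
    have := (abs_lt.1 h1).1
    linarith
  -- on the small ball the signs are constant, so `F` is a fixed linear combination of sheets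
  have hconst : ∀ j, ∀ ξ ∈ ball ξ₀ δ,
      (if (![ξ + (c : ℂ) * y j ξ, y j ξ] : Fin 2 → ℂ) ∈ H then (1 : ℂ) else -1) =
        (if (![ξ₀ + (c : ℂ) * y j ξ₀, y j ξ₀] : Fin 2 → ℂ) ∈ H then (1 : ℂ) else -1) := by
    intro j ξ hξ
    refine sign_sheet_eq hH hN hdisj hQp (convex_ball ξ₀ δ).isPreconnected him
      (fun ξ' hξ' => (hya j ξ' (hball hξ')).continuousAt.continuousWithinAt) (fun ξ' hξ' => ?_)
      (mem_ball_self hδpos) hξ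
    have hmem : y j ξ' ∈ (Q.map (eval₂RingHom (algebraMap ℚ ℂ) ξ')).roots := by
      rw [hroots ξ' (hball hξ')]
      exact Multiset.mem_map.2 ⟨j, Finset.mem_univ_val j, rfl⟩
    exact ((mem_roots (hmonic.map _).ne_zero).1 hmem).eq_zero
  have hev : F =ᶠ[𝓝 ξ₀] fun ξ => ∑ j,
      (if (![ξ₀ + (c : ℂ) * y j ξ₀, y j ξ₀] : Fin 2 → ℂ) ∈ H then (1 : ℂ) else -1) * y j ξ := by
    filter_upwards [ball_mem_nhds ξ₀ hδpos] with ξ hξ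
    rw [fibreSum_eq_sum_sheets hF (hroots ξ (hball hξ))]
    exact Finset.sum_congr rfl fun j _ => by rw [hconst j ξ hξ]
  refine (hev.differentiableAt_iff).2 ?_
  exact DifferentiableAt.fun_sum fun j _ =>
    ((hya j ξ₀ (mem_ball_self hε)).differentiableAt.const_mul _)

/-! ### The fibre sum is locally bounded -/

/-- The fibres of the monic `Q` in the `aeval` notation of `ComplexOrientationFormulaProofs`.
[folklore] -/
theorem map_aeval_eq_map_eval₂RingHom (Q : ℚ[X][X]) (ξ : ℂ) :
    Q.map (Polynomial.aeval ξ : ℚ[X] →ₐ[ℚ] ℂ).toRingHom = Q.map (eval₂RingHom (algebraMap ℚ ℂ) ξ) := by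
  congr 1

/-- **Root bound**: `|F(ξ)| ≤ d · (Σ_{i<d} |Qᵢ(ξ)| + 1)`, a continuous function of `ξ`.
[folklore] -/
theorem norm_fibreSum_le (hmonic : Q.Monic)
    (hF : ∀ ξ : ℂ, F ξ = (((Q.map (eval₂RingHom (algebraMap ℚ ℂ) ξ)).roots.map fun y =>
      (if (![ξ + (c : ℂ) * y, y] : Fin 2 → ℂ) ∈ H then (1 : ℂ) else -1) * y)).sum) (ξ : ℂ) :
    ‖F ξ‖ ≤ Q.natDegree *
      ((∑ i ∈ Finset.range Q.natDegree, ‖Polynomial.aeval ξ (Q.coeff i)‖) / ‖((1 : ℚ) : ℂ)‖ + 1) := by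
  have hlead : Q.leadingCoeff = Polynomial.C 1 := by rw [map_one]; exact hmonic
  set bd : ℝ := (∑ i ∈ Finset.range Q.natDegree, ‖Polynomial.aeval ξ (Q.coeff i)‖) /
    ‖((1 : ℚ) : ℂ)‖ + 1 with hbd
  have hroot : ∀ y ∈ (Q.map (eval₂RingHom (algebraMap ℚ ℂ) ξ)).roots, ‖y‖ ≤ bd := by
    intro y hy
    have hy' : (Q.map (Polynomial.aeval ξ : ℚ[X] →ₐ[ℚ] ℂ).toRingHom).IsRoot y := by
      rw [map_aeval_eq_map_eval₂RingHom]
      exact (mem_roots (hmonic.map _).ne_zero).1 hy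
    exact ShearMonic.norm_root_fibre_le rfl hlead one_ne_zero hy'
  rw [hF]
  refine (norm_multiset_sum_le _).trans ?_
  rw [Multiset.map_map]
  have hcard : Multiset.card (Q.map (eval₂RingHom (algebraMap ℚ ℂ) ξ)).roots = Q.natDegree := by
    rw [← map_aeval_eq_map_eval₂RingHom]
    exact ShearMonic.card_roots_fibre rfl hlead one_ne_zero ξ
  have h := Multiset.sum_le_card_nsmul
    ((Q.map (eval₂RingHom (algebraMap ℚ ℂ) ξ)).roots.map (Function.comp norm fun y =>
      (if (![ξ + (c : ℂ) * y, y] : Fin 2 → ℂ) ∈ H then (1 : ℂ) else -1) * y)) bd ?_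
  · rw [Multiset.card_map, hcard, nsmul_eq_mul] at h
    exact h
  · intro b hb
    obtain ⟨y, hy, rfl⟩ := Multiset.mem_map.1 hb
    simp only [Function.comp_apply, norm_mul]
    have h1 : ‖(if (![ξ + (c : ℂ) * y, y] : Fin 2 → ℂ) ∈ H then (1 : ℂ) else -1)‖ = 1 := by
      split_ifs <;> simp
    rw [h1, one_mul]
    exact hroot y hy

/-- The root bound is continuous, so `F` is bounded on bounded sets. [folklore] -/
theorem exists_norm_fibreSum_le_of_isCompact (hmonic : Q.Monic)
    (hF : ∀ ξ : ℂ, F ξ = (((Q.map (eval₂RingHom (algebraMap ℚ ℂ) ξ)).roots.map fun y =>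
      (if (![ξ + (c : ℂ) * y, y] : Fin 2 → ℂ) ∈ H then (1 : ℂ) else -1) * y)).sum)
    {K : Set ℂ} (hK : IsCompact K) : ∃ B : ℝ, ∀ ξ ∈ K, ‖F ξ‖ ≤ B := by
  have hcont : Continuous fun ξ : ℂ => (Q.natDegree : ℝ) *
      ((∑ i ∈ Finset.range Q.natDegree, ‖Polynomial.aeval ξ (Q.coeff i)‖) / ‖((1 : ℚ) : ℂ)‖ + 1) :=
    continuous_const.mul (ShearMonic.continuous_rootBound Q 1 Q.natDegree)
  obtain ⟨B, hB⟩ := hK.exists_bound_of_continuousOn hcont.continuousOn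
  refine ⟨B, fun ξ hξ => (norm_fibreSum_le hmonic hF ξ).trans ?_⟩
  exact (le_abs_self _).trans ((Real.norm_eq_abs _).symm.le.trans (hB ξ hξ))

/-! ### Riemann: a holomorphic representative on the whole upper half-plane -/

/-- **The holomorphic fibre sum.** There is `F'` holomorphic on the open upper half-plane which
agrees with the fibre sum `F` off the finite set of `ξ` with `g(ξ) = 0` (`g` from the Bézout
identity). [folklore] -/
theorem exists_holomorphic_fibreSum (hH : IsHalf p H) (hN : nonRealLocus p = H ∪ star '' H)
    (hdisj : Disjoint H (star '' H)) (hmonic : Q.Monic)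
    (hQp : ∀ ξ y : ℂ, (Q.map (eval₂RingHom (algebraMap ℚ ℂ) ξ)).eval y = 0 ↔
      aeval (![ξ + (c : ℂ) * y, y] : Fin 2 → ℂ) p = 0)
    (hF : ∀ ξ : ℂ, F ξ = (((Q.map (eval₂RingHom (algebraMap ℚ ℂ) ξ)).roots.map fun y =>
      (if (![ξ + (c : ℂ) * y, y] : Fin 2 → ℂ) ∈ H then (1 : ℂ) else -1) * y)).sum)
    {A B : ℚ[X][X]} {g : ℚ[X]} (hg0 : g ≠ 0) (hbez : A * Q + B * derivative Q = Polynomial.C g) :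
    ∃ F' : ℂ → ℂ, DifferentiableOn ℂ F' {z : ℂ | 0 < z.im} ∧
      ∀ z : ℂ, 0 < z.im → Polynomial.aeval z g ≠ 0 → F' z = F z := by
  classical
  set T : Finset ℂ := (g.map (algebraMap ℚ ℂ)).roots.toFinset with hT
  have hTiff : ∀ z : ℂ, z ∈ T ↔ Polynomial.aeval z g = 0 := by
    intro z
    rw [hT, Multiset.mem_toFinset, mem_roots ((Polynomial.map_ne_zero_iff
      (algebraMap ℚ ℂ).injective).2 hg0), IsRoot.def, Polynomial.eval_map, ← Polynomial.aeval_def]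
  have hopen : IsOpen {z : ℂ | 0 < z.im} := isOpen_lt continuous_const Complex.continuous_im
  have hdiff : DifferentiableOn ℂ F ({z : ℂ | 0 < z.im} \ ↑T) := fun z hz =>
    (differentiableAt_fibreSum hH hN hdisj hmonic hQp hF hbez hz.1
      (fun h => hz.2 ((hTiff z).2 h))).differentiableWithinAt
  have hb : ∀ c' ∈ T, ∃ M : ℝ, ∃ s ∈ 𝓝 c', ∀ z ∈ s, z ∉ T → ‖F z‖ ≤ M := by
    intro c' _
    obtain ⟨B, hB⟩ := exists_norm_fibreSum_le_of_isCompact hmonic hF (isCompact_closedBall c' 1)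
    exact ⟨B, closedBall c' 1, closedBall_mem_nhds c' one_pos, fun z hz _ => hB z hz⟩
  obtain ⟨F', hF', hEq⟩ := exists_differentiableOn_eqOn_of_finset hopen T hdiff hb
  exact ⟨F', hF', fun z hz hgz => hEq z hz fun h => hgz ((hTiff z).1 h)⟩

end Sheets

end Literature.AlgebraicGeometry.RealAlgebraic
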